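import Summits.QuantumFields.BalabanUV.Beta.GAN24.SecondOrderLipschitzBi
import Summits.QuantumFields.BalabanUV.Beta.GAN24.SecondOrderLipschitzResp

/-!
# `BalabanUV.Beta.GAN24.SecondOrderLipschitzW2` — THE SECOND-ORDER RESPONSE CARRIER IS LIPSCHITZ IN ITS ARGUMENTS, part 4 (assembly):
# `W2OfK`, its swap, the symmetrised carrier `W2SymOfK`, and the FAMILY (CAUCHY) FORM — the shape of the wall's W-row `hW₂all`
# (G-an2-4 formalisation swarm, leaf prover 03, gen 16; generic engine toward the W-slot's CAUCHY binder `hWall` ∕ `hW₂all`)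

NOT IN PRINT; OUR PROOF (elementary).  HONEST FRAMING (cell contract, verbatim): «discharging `BetaPertH` makes Bałaban's UV stability
UNCONDITIONAL — a real constructive-QFT result; it is NOT the continuum limit and NOT the Clay problem.»  HONEST DEPENDENCY (verbatim):
«continuum YM on T⁴ ⇐ BetaPertH ∧ nine spine estimates (0/9 proved); BetaPertH ⇐ (D1) ∧ (D4) ∧ CAP+tail; G-an2-4 gates asym, D1 and
NE2/3/4.»

WHAT ([folklore]; parts 1–3: `GAN24/SecondOrderLipschitz`, `…Bi`, `…Resp`).  For packed kernels `K, K′` (`Decays · C m`, deviation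
`Decays (K − K′) εK m`), first tables `S, S′` (`LocStencil · Cs m`, deviation `εS`), `M, M′` (`VertexFamily · N CM m`, `εM`), second tables `S₂, S₂′`
(`LocStencil₂ · C₂ m`, `ε₂`), `M₂, M₂′` (`LocStencilFM N · CM₂ m`, `εM₂`):
* `LW2 d C Cs CM C₂ CM₂ εK εS εM ε₂ εM₂ m` — the Lipschitz constant (an2's `CW2` with one factor a deviation in each monomial: three `lBi` + the
  second-response `ldM` over the derivative-of-the-inverse data `cK2` ∕ `lK2` at rate `m/8`), `LW2_nonneg`, and **`LW2_mul`**: LINEAR HOMOGENEITY in the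
  five deviations (`ring`) — which is what turns the Lipschitz estimate into a geometric-rate estimate;
* **`vertexFamily₂_W2OfK_sub`**: `VertexFamily₂ (W2OfK K N S M S₂ M₂ − W2OfK K′ N S′ M′ S₂′ M₂′) N (LW2 …) (m/16)`; **`vertexFamily₂_W2OfK_swap_sub`** (index
  order of `W`); **`vertexFamily₂_W2SymOfK_sub`** — THE SYMMETRISED CARRIER IS LIPSCHITZ, same constant, rate `m/16` (= the rate of an2's
  `vertexFamily₂_W2SymOfK`);
* **`vertexFamily₂_W2SymOfK_cauchy`** — FAMILY FORM: for families `K_j, S_j, M_j, S₂_j, M₂_j` with `j`-UNIFORM data and PAIRWISE deviations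
  `c·θ^k` between members `k+j` and `k` (the shapes of `GAN24/CombesThomas.CauchyDecayK` ∕ of «E3Drift»-type rows),
  `∀ k j, VertexFamily₂ (W2SymOfK (K (k+j)) N (S (k+j)) (M (k+j)) (S₂ (k+j)) (M₂ (k+j)) − W2SymOfK (K k) N (S k) (M k) (S₂ k) (M₂ k)) N (LW2 (…, cK, cS, cM, c₂, cM₂, m)·θ^k) (m/16)`
  — LITERALLY the shape of the binder `hW₂all` of `StencilSlotWallThree.d1Drift_JsBalOf_iff_three_of_diffRows` (resp. `hWall` of
  `HessKerDressedUnitsWall.d1Drift_JsBalOf_iff_of_cauchy_unit`) once an2's dressed family is rewritten by an4's `SecondOrderUnits.unitW_WbalOf`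
  (`unitW_j (WbalOf … j) = W2SymOfK (unitK_j K_j) Lc (unitS_j (Spure j)) (unitM_j (M1 j)) (unitS₂_j (T₂ j)) (unitM₂_j (M2Of mixFF j))`): the W-slot's Cauchy
  binder REDUCES to the K-slot (`UnitDecayK` ∕ `CauchyDecayK`, tree theorems at `d = 3`), the normalised `Spure` family («E3Shape» ∕ «E3Drift», tree
  theorems at `d = 3`, + the `j`-free (V-H) piece), the `j`-free normalised `M1` ∕ `M2Of` tables (leaf-07's `WSlotOfShapes.unitM_M1_eq` ∕
  `unitM₂_M2Of_eq`: deviation ZERO) and the located shapes «T2Shape» ∕ «T2Drift» of the normalised bi-stencil family `T₂` — that reduction is the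
  W-slot holder's to write; this file is its engine.

HONEST: generic kernel algebra over an2's carriers; instantiates NO binder of the wall, asserts NO shape of Bałaban's tables («T2Shape» ∕
«T2Drift» stay located ∕ OPEN), discharges NOTHING of (hW, hWall); NOT «W-slot closed», NEVER «G-an2-4 closed»; NOT BetaPertH, NOT continuum,
NOT Clay.  0 sorry, 0 cite, 0 `def … : Prop`.
-/

noncomputable section

open Finset
open scoped BigOperators
open Literature.MathematicalPhysics.QuantumFieldTheory
open Literature.MathematicalPhysics.QuantumFieldTheory.Balaban1983to89
open Literature.MathematicalPhysics.QuantumFieldTheory.Balaban1983to89.Beta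
open B12Sec2to5 (l1 l1_nonneg)
open ExpKernelCalculus (MKer Decays BiLoc VertexFamily VertexFamily₂ Zl Zl_nonneg)
open OneStepResolventKernel (Fib LocStencil biLoc_mono)
open KernelWard (biLoc_add)
open BalabanStepJets (locStencil_mono vertexFamily₂_mono)
open BalabanCompositeJets (LocStencil₂)
open SecondOrderResponse (dM K2OfK vertex2OfK mixOfK W2OfK W2SymOfK LocStencilFM cdM cK2 cdM_nonneg cK2_nonneg vertexFamily_K2OfK
  biLoc_smul)
open Summit.QuantumFields.BalabanUV.Beta.GAN24.SecondOrderLipschitz (ldM ldM_nonneg lSand lK2 lK2_nonneg vertexFamily_K2OfK_sub)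
open Summit.QuantumFields.BalabanUV.Beta.GAN24.SecondOrderLipschitzBi (lBi lBi_nonneg vertexFamily₂_vertex2OfK_sub
  vertexFamily₂_vertex2OfK_swap_sub vertexFamily₂_mixOfK_sub vertexFamily₂_mixOfK_swap_sub)
open Summit.QuantumFields.BalabanUV.Beta.GAN24.SecondOrderLipschitzResp (vertexFamily₂_resp_sub vertexFamily₂_resp_swap_sub)

namespace Summit.QuantumFields.BalabanUV.Beta.GAN24.SecondOrderLipschitzW2

variable {d : ℕ} {N : ℕ} [NeZero N]

/-! ## §1 The Lipschitz constant and its linear homogeneity -/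

/-- [folklore] The Lipschitz constant of the second-order carrier (rate `m` in, `m/16` out): three bi-vertex deviations `lBi` (one for `S₂`, two for
`M₂`) and the second-response deviation `ldM` over the derivative-of-the-inverse data (`cK2`, `lK2`) at rate `m/8` — an2's `CW2` with one factor a
deviation in each monomial. -/
def LW2 (d : ℕ) (C Cs CM C₂ CM₂ εK εS εM ε₂ εM₂ m : ℝ) : ℝ :=
  lBi d C C₂ εK ε₂ m + lBi d C CM₂ εK εM₂ m + lBi d C CM₂ εK εM₂ m
    + ldM d (cK2 d C Cs CM m) Cs CM (lK2 d C Cs CM εK εS εM m) εS εM (m / 8)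

omit [NeZero N] in
/-- [folklore] `LW2` is nonnegative for nonnegative inputs. -/
theorem LW2_nonneg {C Cs CM C₂ CM₂ εK εS εM ε₂ εM₂ m : ℝ} (hC : 0 ≤ C) (hCs : 0 ≤ Cs) (hCM : 0 ≤ CM) (hC₂ : 0 ≤ C₂)
    (hCM₂ : 0 ≤ CM₂) (hεK : 0 ≤ εK) (hεS : 0 ≤ εS) (hεM : 0 ≤ εM) (hε₂ : 0 ≤ ε₂) (hεM₂ : 0 ≤ εM₂) (hm : 0 < m) :
    0 ≤ LW2 d C Cs CM C₂ CM₂ εK εS εM ε₂ εM₂ m := by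
  unfold LW2
  have h1 := lBi_nonneg (d := d) hC hC₂ hεK hε₂ hm
  have h2 := lBi_nonneg (d := d) hC hCM₂ hεK hεM₂ hm
  have h3 : 0 ≤ ldM d (cK2 d C Cs CM m) Cs CM (lK2 d C Cs CM εK εS εM m) εS εM (m / 8) :=
    ldM_nonneg (cK2_nonneg hC hCs hCM hm) hCs hCM (lK2_nonneg hC hCs hCM hεK hεS hεM hm) hεS hεM (by positivity)
  linarith

omit [NeZero N] in
/-- [folklore] **LINEAR HOMOGENEITY OF THE LIPSCHITZ CONSTANT IN THE DEVIATIONS**: scaling all five deviations by `t` scales `LW2` by `t` (every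
monomial of `LW2` carries exactly one deviation). -/
theorem LW2_mul (d : ℕ) (C Cs CM C₂ CM₂ εK εS εM ε₂ εM₂ m t : ℝ) :
    LW2 d C Cs CM C₂ CM₂ (εK * t) (εS * t) (εM * t) (ε₂ * t) (εM₂ * t) m = LW2 d C Cs CM C₂ CM₂ εK εS εM ε₂ εM₂ m * t := by
  simp only [LW2, lBi, ldM, lK2, lSand]
  ring

/-! ## §2 `W2OfK`, its swap, and `W2SymOfK` are Lipschitz -/

section Assembly

variable {K K' : MKer (d + 1) (Fib d)} {C εK m : ℝ}
  {S S' : Fin (d + 1) → (Fin (d + 1) → ℤ) → MKer (d + 1) (Fib d)} {Cs εS : ℝ}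
  {M M' : Fin (d + 1) → (Fin (d + 1) → ℤ) → MKer (d + 1) (Fib d)} {CM εM : ℝ}
  {S₂ S₂' : Fin (d + 1) → (Fin (d + 1) → ℤ) → Fin (d + 1) → (Fin (d + 1) → ℤ) → MKer (d + 1) (Fib d)} {C₂ ε₂ : ℝ}
  {M₂ M₂' : Fin (d + 1) → (Fin (d + 1) → ℤ) → Fin (d + 1) → (Fin (d + 1) → ℤ) → MKer (d + 1) (Fib d)} {CM₂ εM₂ : ℝ}

/-- [folklore] **THE SECOND-ORDER CARRIER IS LIPSCHITZ IN `(K, S, M, S₂, M₂)`**: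
`VertexFamily₂ (W2OfK K N S M S₂ M₂ − W2OfK K′ N S′ M′ S₂′ M₂′) N (LW2 d C Cs CM C₂ CM₂ εK εS εM ε₂ εM₂ m) (m/16)` — the four pieces of an2's `W2OfK_apply`
telescoped: the bi-vertex and the two mixed bi-vertices at rate `m/8` weakened to `m/16` (`SecondOrderLipschitzBi`), the second-response piece through
`vertexFamily_K2OfK_sub` ∕ `vertexFamily₂_resp_sub` at the first tables' rate `m/8`. -/
theorem vertexFamily₂_W2OfK_sub (hK : Decays K C m) (hK' : Decays K' C m) (hKK : Decays (K - K') εK m) (hm : 0 < m)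
    (hS : LocStencil S Cs m) (hS' : LocStencil S' Cs m) (hSS : LocStencil (S - S') εS m)
    (hM : VertexFamily M N CM m) (hM' : VertexFamily M' N CM m) (hMM : VertexFamily (M - M') N εM m)
    (hS₂ : LocStencil₂ S₂ C₂ m) (hS₂' : LocStencil₂ S₂' C₂ m) (hSS₂ : LocStencil₂ (S₂ - S₂') ε₂ m)
    (hM₂ : LocStencilFM N M₂ CM₂ m) (hM₂' : LocStencilFM N M₂' CM₂ m) (hMM₂ : LocStencilFM N (M₂ - M₂') εM₂ m) :
    VertexFamily₂ (W2OfK K N S M S₂ M₂ - W2OfK K' N S' M' S₂' M₂') N (LW2 d C Cs CM C₂ CM₂ εK εS εM ε₂ εM₂ m) (m / 16) := by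
  have hC : 0 ≤ C := hK.nonneg (Sum.inl 0)
  have hεK : 0 ≤ εK := hKK.nonneg (Sum.inl 0)
  have hCs : 0 ≤ Cs := (hS 0 0).nonneg (Sum.inl 0)
  have hεS : 0 ≤ εS := (hSS 0 0).nonneg (Sum.inl 0)
  have hCM : 0 ≤ CM := (hM 0 0).nonneg (Sum.inl 0)
  have hεM : 0 ≤ εM := (hMM 0 0).nonneg (Sum.inl 0)
  have hC₂ := hS₂.nonneg
  have hε₂ := hSS₂.nonneg
  have hCM₂ := hM₂.nonneg
  have hεM₂ := hMM₂.nonneg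
  have h16 : m / 16 ≤ m / 8 := by linarith
  have h1 : VertexFamily₂ (vertex2OfK K N S₂ - vertex2OfK K' N S₂') N (lBi d C C₂ εK ε₂ m) (m / 16) :=
    vertexFamily₂_mono (vertexFamily₂_vertex2OfK_sub hK hK' hKK hm hS₂ hS₂' hSS₂) (lBi_nonneg hC hC₂ hεK hε₂ hm) h16
  have h2 : VertexFamily₂ (mixOfK K N M₂ - mixOfK K' N M₂') N (lBi d C CM₂ εK εM₂ m) (m / 16) :=
    vertexFamily₂_mono (vertexFamily₂_mixOfK_sub hK hK' hKK hm hM₂ hM₂' hMM₂) (lBi_nonneg hC hCM₂ hεK hεM₂ hm) h16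
  have h3 : VertexFamily₂ (fun μ y ν y' => (mixOfK K N M₂ - mixOfK K' N M₂') ν y' μ y) N (lBi d C CM₂ εK εM₂ m) (m / 16) :=
    vertexFamily₂_mono (vertexFamily₂_mixOfK_swap_sub hK hK' hKK hm hM₂ hM₂' hMM₂) (lBi_nonneg hC hCM₂ hεK hεM₂ hm) h16
  -- the second-response piece: the derivative of the inverse is a Lipschitz vertex family at rate `m/8`
  have hK2 : VertexFamily (K2OfK K N S M) N (cK2 d C Cs CM m) (m / 8) := vertexFamily_K2OfK hK hC hm hS hM
  have hK2' : VertexFamily (K2OfK K' N S' M') N (cK2 d C Cs CM m) (m / 8) := vertexFamily_K2OfK hK' hC hm hS' hM'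
  have hKK2 : VertexFamily (K2OfK K N S M - K2OfK K' N S' M') N (lK2 d C Cs CM εK εS εM m) (m / 8) :=
    vertexFamily_K2OfK_sub hK hK' hKK hm hS hS' hSS hM hM' hMM
  have hm8 : 0 < m / 8 := by positivity
  have hS8 : LocStencil S Cs (m / 8) := locStencil_mono hS hCs (by linarith)
  have hS8' : LocStencil S' Cs (m / 8) := locStencil_mono hS' hCs (by linarith)
  have hSS8 : LocStencil (S - S') εS (m / 8) := locStencil_mono hSS hεS (by linarith)
  have hM8 : VertexFamily M N CM (m / 8) := fun μ y => biLoc_mono (hM μ y) hCM (by linarith)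
  have hM8' : VertexFamily M' N CM (m / 8) := fun μ y => biLoc_mono (hM' μ y) hCM (by linarith)
  have hMM8 : VertexFamily (M - M') N εM (m / 8) := fun μ y => biLoc_mono (hMM μ y) hεM (by linarith)
  have h4 := vertexFamily₂_resp_sub hK2 hK2' hKK2 hS8 hS8' hSS8 hM8 hM8' hMM8 hm8
  rw [show m / 8 / 2 = m / 16 by ring] at h4
  intro μ y ν y'
  have h := biLoc_add (biLoc_add (biLoc_add (h1 μ y ν y') (h2 μ y ν y')) (h3 μ y ν y')) (h4 μ y ν y')
  have e : (W2OfK K N S M S₂ M₂ - W2OfK K' N S' M' S₂' M₂') μ y ν y'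
      = (vertex2OfK K N S₂ - vertex2OfK K' N S₂') μ y ν y' + (mixOfK K N M₂ - mixOfK K' N M₂') μ y ν y'
        + (fun μ y ν y' => (mixOfK K N M₂ - mixOfK K' N M₂') ν y' μ y) μ y ν y'
        + (fun μ y ν y' => dM (K2OfK K N S M ν y') N S M μ y - dM (K2OfK K' N S' M' ν y') N S' M' μ y) μ y ν y' := by
    funext x z a b
    simp only [W2OfK, Pi.sub_apply, Pi.add_apply]
    ring
  rw [e]
  unfold LW2
  exact h

/-- [folklore] **THE EXCHANGED SECOND-ORDER CARRIER IS LIPSCHITZ** (index order of `W`): `(μ, y, ν, y′) ↦ (W2OfK … − W2OfK′ …) ν y′ μ y` is a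
`VertexFamily₂` with the same constant `LW2` and rate `m/16` (the four exchanged pieces). -/
theorem vertexFamily₂_W2OfK_swap_sub (hK : Decays K C m) (hK' : Decays K' C m) (hKK : Decays (K - K') εK m) (hm : 0 < m)
    (hS : LocStencil S Cs m) (hS' : LocStencil S' Cs m) (hSS : LocStencil (S - S') εS m)
    (hM : VertexFamily M N CM m) (hM' : VertexFamily M' N CM m) (hMM : VertexFamily (M - M') N εM m)
    (hS₂ : LocStencil₂ S₂ C₂ m) (hS₂' : LocStencil₂ S₂' C₂ m) (hSS₂ : LocStencil₂ (S₂ - S₂') ε₂ m)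
    (hM₂ : LocStencilFM N M₂ CM₂ m) (hM₂' : LocStencilFM N M₂' CM₂ m) (hMM₂ : LocStencilFM N (M₂ - M₂') εM₂ m) :
    VertexFamily₂ (fun μ y ν y' => (W2OfK K N S M S₂ M₂ - W2OfK K' N S' M' S₂' M₂') ν y' μ y) N
      (LW2 d C Cs CM C₂ CM₂ εK εS εM ε₂ εM₂ m) (m / 16) := by
  have hC : 0 ≤ C := hK.nonneg (Sum.inl 0)
  have hεK : 0 ≤ εK := hKK.nonneg (Sum.inl 0)
  have hCs : 0 ≤ Cs := (hS 0 0).nonneg (Sum.inl 0)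
  have hεS : 0 ≤ εS := (hSS 0 0).nonneg (Sum.inl 0)
  have hCM : 0 ≤ CM := (hM 0 0).nonneg (Sum.inl 0)
  have hεM : 0 ≤ εM := (hMM 0 0).nonneg (Sum.inl 0)
  have hC₂ := hS₂.nonneg
  have hε₂ := hSS₂.nonneg
  have hCM₂ := hM₂.nonneg
  have hεM₂ := hMM₂.nonneg
  have h16 : m / 16 ≤ m / 8 := by linarith
  have h1 : VertexFamily₂ (fun μ y ν y' => (vertex2OfK K N S₂ - vertex2OfK K' N S₂') ν y' μ y) N (lBi d C C₂ εK ε₂ m) (m / 16) :=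
    vertexFamily₂_mono (vertexFamily₂_vertex2OfK_swap_sub hK hK' hKK hm hS₂ hS₂' hSS₂) (lBi_nonneg hC hC₂ hεK hε₂ hm) h16
  have h2 : VertexFamily₂ (fun μ y ν y' => (mixOfK K N M₂ - mixOfK K' N M₂') ν y' μ y) N (lBi d C CM₂ εK εM₂ m) (m / 16) :=
    vertexFamily₂_mono (vertexFamily₂_mixOfK_swap_sub hK hK' hKK hm hM₂ hM₂' hMM₂) (lBi_nonneg hC hCM₂ hεK hεM₂ hm) h16
  have h3 : VertexFamily₂ (mixOfK K N M₂ - mixOfK K' N M₂') N (lBi d C CM₂ εK εM₂ m) (m / 16) :=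
    vertexFamily₂_mono (vertexFamily₂_mixOfK_sub hK hK' hKK hm hM₂ hM₂' hMM₂) (lBi_nonneg hC hCM₂ hεK hεM₂ hm) h16
  have hK2 : VertexFamily (K2OfK K N S M) N (cK2 d C Cs CM m) (m / 8) := vertexFamily_K2OfK hK hC hm hS hM
  have hK2' : VertexFamily (K2OfK K' N S' M') N (cK2 d C Cs CM m) (m / 8) := vertexFamily_K2OfK hK' hC hm hS' hM'
  have hKK2 : VertexFamily (K2OfK K N S M - K2OfK K' N S' M') N (lK2 d C Cs CM εK εS εM m) (m / 8) :=
    vertexFamily_K2OfK_sub hK hK' hKK hm hS hS' hSS hM hM' hMM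
  have hm8 : 0 < m / 8 := by positivity
  have hS8 : LocStencil S Cs (m / 8) := locStencil_mono hS hCs (by linarith)
  have hS8' : LocStencil S' Cs (m / 8) := locStencil_mono hS' hCs (by linarith)
  have hSS8 : LocStencil (S - S') εS (m / 8) := locStencil_mono hSS hεS (by linarith)
  have hM8 : VertexFamily M N CM (m / 8) := fun μ y => biLoc_mono (hM μ y) hCM (by linarith)
  have hM8' : VertexFamily M' N CM (m / 8) := fun μ y => biLoc_mono (hM' μ y) hCM (by linarith)
  have hMM8 : VertexFamily (M - M') N εM (m / 8) := fun μ y => biLoc_mono (hMM μ y) hεM (by linarith)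
  have h4 := vertexFamily₂_resp_swap_sub hK2 hK2' hKK2 hS8 hS8' hSS8 hM8 hM8' hMM8 hm8
  rw [show m / 8 / 2 = m / 16 by ring] at h4
  intro μ y ν y'
  have h := biLoc_add (biLoc_add (biLoc_add (h1 μ y ν y') (h2 μ y ν y')) (h3 μ y ν y')) (h4 μ y ν y')
  show BiLoc ((W2OfK K N S M S₂ M₂ - W2OfK K' N S' M' S₂' M₂') ν y' μ y) ((N : ℤ) • y) ((N : ℤ) • y')
    (LW2 d C Cs CM C₂ CM₂ εK εS εM ε₂ εM₂ m) (m / 16)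
  have e : (W2OfK K N S M S₂ M₂ - W2OfK K' N S' M' S₂' M₂') ν y' μ y
      = (fun μ y ν y' => (vertex2OfK K N S₂ - vertex2OfK K' N S₂') ν y' μ y) μ y ν y'
        + (fun μ y ν y' => (mixOfK K N M₂ - mixOfK K' N M₂') ν y' μ y) μ y ν y'
        + (mixOfK K N M₂ - mixOfK K' N M₂') μ y ν y'
        + (fun μ y ν y' => dM (K2OfK K N S M μ y) N S M ν y' - dM (K2OfK K' N S' M' μ y) N S' M' ν y') μ y ν y' := by
    funext x z a b
    simp only [W2OfK, Pi.sub_apply, Pi.add_apply]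
    ring
  rw [e]
  unfold LW2
  exact h

/-- [folklore] **THE SYMMETRISED SECOND-ORDER CARRIER IS LIPSCHITZ IN `(K, S, M, S₂, M₂)`**:
`VertexFamily₂ (W2SymOfK K N S M S₂ M₂ − W2SymOfK K′ N S′ M′ S₂′ M₂′) N (LW2 d C Cs CM C₂ CM₂ εK εS εM ε₂ εM₂ m) (m/16)` — the order-two twin of asym1's
`HessKerRate.vertexFamily_vertexOfK_sub`, same rate as an2's `vertexFamily₂_W2SymOfK` (`biLoc_smul` with `|½|·(LW2 + LW2) = LW2`). -/
theorem vertexFamily₂_W2SymOfK_sub (hK : Decays K C m) (hK' : Decays K' C m) (hKK : Decays (K - K') εK m) (hm : 0 < m)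
    (hS : LocStencil S Cs m) (hS' : LocStencil S' Cs m) (hSS : LocStencil (S - S') εS m)
    (hM : VertexFamily M N CM m) (hM' : VertexFamily M' N CM m) (hMM : VertexFamily (M - M') N εM m)
    (hS₂ : LocStencil₂ S₂ C₂ m) (hS₂' : LocStencil₂ S₂' C₂ m) (hSS₂ : LocStencil₂ (S₂ - S₂') ε₂ m)
    (hM₂ : LocStencilFM N M₂ CM₂ m) (hM₂' : LocStencilFM N M₂' CM₂ m) (hMM₂ : LocStencilFM N (M₂ - M₂') εM₂ m) :
    VertexFamily₂ (W2SymOfK K N S M S₂ M₂ - W2SymOfK K' N S' M' S₂' M₂') N (LW2 d C Cs CM C₂ CM₂ εK εS εM ε₂ εM₂ m) (m / 16) := by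
  have ha := vertexFamily₂_W2OfK_sub hK hK' hKK hm hS hS' hSS hM hM' hMM hS₂ hS₂' hSS₂ hM₂ hM₂' hMM₂
  have hb := vertexFamily₂_W2OfK_swap_sub hK hK' hKK hm hS hS' hSS hM hM' hMM hS₂ hS₂' hSS₂ hM₂ hM₂' hMM₂
  intro μ y ν y'
  have h := biLoc_smul (1 / 2 : ℝ) (biLoc_add (ha μ y ν y') (hb μ y ν y'))
  have e1 : |(1 / 2 : ℝ)| * (LW2 d C Cs CM C₂ CM₂ εK εS εM ε₂ εM₂ m + LW2 d C Cs CM C₂ CM₂ εK εS εM ε₂ εM₂ m)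
      = LW2 d C Cs CM C₂ CM₂ εK εS εM ε₂ εM₂ m := by
    rw [abs_of_pos (by norm_num : (0 : ℝ) < 1 / 2)]
    ring
  rw [e1] at h
  have e : (W2SymOfK K N S M S₂ M₂ - W2SymOfK K' N S' M' S₂' M₂') μ y ν y'
      = (1 / 2 : ℝ) • ((W2OfK K N S M S₂ M₂ - W2OfK K' N S' M' S₂' M₂') μ y ν y'
          + (fun μ y ν y' => (W2OfK K N S M S₂ M₂ - W2OfK K' N S' M' S₂' M₂') ν y' μ y) μ y ν y') := by
    funext x z a b
    simp only [W2SymOfK, Pi.sub_apply, Pi.add_apply, Pi.smul_apply, smul_eq_mul]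
    ring
  rw [e]
  exact h

end Assembly

/-! ## §3 The family (Cauchy) form — the shape of the wall's W-row `hW₂all` -/

section Family

variable {K : ℕ → MKer (d + 1) (Fib d)}
  {S : ℕ → Fin (d + 1) → (Fin (d + 1) → ℤ) → MKer (d + 1) (Fib d)}
  {M : ℕ → Fin (d + 1) → (Fin (d + 1) → ℤ) → MKer (d + 1) (Fib d)}
  {S₂ : ℕ → Fin (d + 1) → (Fin (d + 1) → ℤ) → Fin (d + 1) → (Fin (d + 1) → ℤ) → MKer (d + 1) (Fib d)}
  {M₂ : ℕ → Fin (d + 1) → (Fin (d + 1) → ℤ) → Fin (d + 1) → (Fin (d + 1) → ℤ) → MKer (d + 1) (Fib d)}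
  {C Cs CM C₂ CM₂ cK cS cM c₂ cM₂ m θ : ℝ}

/-- [folklore] **CAUCHY FORM: GEOMETRICALLY CONVERGENT DATA ⟹ GEOMETRICALLY CONVERGENT SECOND-ORDER FAMILY.**  For families of packed kernels
and tables with `j`-UNIFORM localisation data (`C, Cs, CM, C₂, CM₂` at rate `m`) whose members `k+j` and `k` differ by deviations `cK·θ^k`, `cS·θ^k`,
`cM·θ^k`, `c₂·θ^k`, `cM₂·θ^k` in the same classes, the symmetrised second-order families differ by a `VertexFamily₂` with constant
`LW2 (…, cK, cS, cM, c₂, cM₂, m)·θ^k`, rate `m/16` — the SHAPE of the wall's binder `hW₂all` (no sign or size condition on `θ` is used here; the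
consumer supplies `0 ≤ θ < 1`). -/
theorem vertexFamily₂_W2SymOfK_cauchy (hm : 0 < m)
    (hK : ∀ j, Decays (K j) C m) (hKc : ∀ k j, Decays (K (k + j) - K k) (cK * θ ^ k) m)
    (hS : ∀ j, LocStencil (S j) Cs m) (hSc : ∀ k j, LocStencil (S (k + j) - S k) (cS * θ ^ k) m)
    (hM : ∀ j, VertexFamily (M j) N CM m) (hMc : ∀ k j, VertexFamily (M (k + j) - M k) N (cM * θ ^ k) m)
    (hS₂ : ∀ j, LocStencil₂ (S₂ j) C₂ m) (hS₂c : ∀ k j, LocStencil₂ (S₂ (k + j) - S₂ k) (c₂ * θ ^ k) m)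
    (hM₂ : ∀ j, LocStencilFM N (M₂ j) CM₂ m) (hM₂c : ∀ k j, LocStencilFM N (M₂ (k + j) - M₂ k) (cM₂ * θ ^ k) m) (k j : ℕ) :
    VertexFamily₂ (W2SymOfK (K (k + j)) N (S (k + j)) (M (k + j)) (S₂ (k + j)) (M₂ (k + j))
        - W2SymOfK (K k) N (S k) (M k) (S₂ k) (M₂ k)) N (LW2 d C Cs CM C₂ CM₂ cK cS cM c₂ cM₂ m * θ ^ k) (m / 16) := by
  have h := vertexFamily₂_W2SymOfK_sub (hK (k + j)) (hK k) (hKc k j) hm (hS (k + j)) (hS k) (hSc k j) (hM (k + j)) (hM k)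
    (hMc k j) (hS₂ (k + j)) (hS₂ k) (hS₂c k j) (hM₂ (k + j)) (hM₂ k) (hM₂c k j)
  rw [LW2_mul] at h
  exact h

/-- [folklore] **THE W-ROW PAIR, PACKAGED**: uniform data + geometric pairwise deviations ⟹ `∃ Cw cW, 0 ≤ cW ∧ (∀ j, VertexFamily₂ (W2SymOfK_j) N Cw (m/16)) ∧
(∀ k j, VertexFamily₂ (W2SymOfK_{k+j} − W2SymOfK_k) N (cW·θ^k) (m/16))` — the shapes of the binders `(hW₂, hW₂all)` of
`StencilSlotWallThree.d1Drift_JsBalOf_iff_three_of_diffRows` at a common rate, uniform half by an2's `vertexFamily₂_W2SymOfK`. -/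
theorem vertexFamily₂_W2SymOfK_uniform_cauchy (hm : 0 < m)
    (hK : ∀ j, Decays (K j) C m) (hKc : ∀ k j, Decays (K (k + j) - K k) (cK * θ ^ k) m)
    (hS : ∀ j, LocStencil (S j) Cs m) (hSc : ∀ k j, LocStencil (S (k + j) - S k) (cS * θ ^ k) m)
    (hM : ∀ j, VertexFamily (M j) N CM m) (hMc : ∀ k j, VertexFamily (M (k + j) - M k) N (cM * θ ^ k) m)
    (hS₂ : ∀ j, LocStencil₂ (S₂ j) C₂ m) (hS₂c : ∀ k j, LocStencil₂ (S₂ (k + j) - S₂ k) (c₂ * θ ^ k) m)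
    (hM₂ : ∀ j, LocStencilFM N (M₂ j) CM₂ m) (hM₂c : ∀ k j, LocStencilFM N (M₂ (k + j) - M₂ k) (cM₂ * θ ^ k) m) :
    ∃ Cw cW : ℝ, 0 ≤ cW ∧
      (∀ j, VertexFamily₂ (W2SymOfK (K j) N (S j) (M j) (S₂ j) (M₂ j)) N Cw (m / 16)) ∧
      (∀ k j, VertexFamily₂ (W2SymOfK (K (k + j)) N (S (k + j)) (M (k + j)) (S₂ (k + j)) (M₂ (k + j))
        - W2SymOfK (K k) N (S k) (M k) (S₂ k) (M₂ k)) N (cW * θ ^ k) (m / 16)) := by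
  have hC : 0 ≤ C := (hK 0).nonneg (Sum.inl 0)
  have hCs : 0 ≤ Cs := (hS 0 0 0).nonneg (Sum.inl 0)
  have hCM : 0 ≤ CM := (hM 0 0 0).nonneg (Sum.inl 0)
  have hcK : 0 ≤ cK := by simpa using (hKc 0 0).nonneg (Sum.inl 0)
  have hcS : 0 ≤ cS := by simpa using (hSc 0 0 0 0).nonneg (Sum.inl 0)
  have hcM : 0 ≤ cM := by simpa using (hMc 0 0 0 0).nonneg (Sum.inl 0)
  have hc₂ : 0 ≤ c₂ := by simpa using (hS₂c 0 0).nonneg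
  have hcM₂ : 0 ≤ cM₂ := by simpa using (hM₂c 0 0).nonneg
  refine ⟨SecondOrderResponse.CW2 d C Cs CM C₂ CM₂ m, LW2 d C Cs CM C₂ CM₂ cK cS cM c₂ cM₂ m,
    LW2_nonneg hC hCs hCM (hS₂ 0).nonneg (hM₂ 0).nonneg hcK hcS hcM hc₂ hcM₂ hm,
    fun j => SecondOrderResponse.vertexFamily₂_W2SymOfK (hK j) hC hm (hS j) (hM j) (hS₂ j) (hM₂ j), fun k j => ?_⟩
  exact vertexFamily₂_W2SymOfK_cauchy hm hK hKc hS hSc hM hMc hS₂ hS₂c hM₂ hM₂c k j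

end Family

end Summit.QuantumFields.BalabanUV.Beta.GAN24.SecondOrderLipschitzW2

end
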